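import Summits.QuantumFields.YangMills.Theorems.BalabanUVNodesN15PartitionTwoGridFitSecond
import Summits.QuantumFields.YangMills.Theorems.BalabanUVNodesN15KingTorusLine
import HarnessLib

/-!
# THE QUADRATIC PARTITION OF UNITY (2.36), VII: the sampled partition ON KING'S TORUS PAIR `blockOf L N : Tor (fine L N) → Tor N` — the coordinates `ξ_ν(x) = x_ν.val∕m`
# (`N_ν = K·m`: `K` cubes of side `m` per direction) SATISFY FILE 61's shift compatibility `hξ` (wrap `z ∈ {0, −1}`), the fine ones `ξ′_ν(x′) = x′_ν.val∕(Lm)` too, and FILE 64's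
# block-offset hypothesis `hoff` (`ξ′_ν x′ = ξ_ν(blockOf x′) + j_ν∕(Lm)`, `0 ≤ j_ν < L`); hence EVERY partition hypothesis `hh h236 hh1 hh1b hh2 hfit hf1 hf1b hf2` of FILES 45–58 is
# INHABITED on the carrier of record with explicit constants (dag-n15-w4 g0, width seat on N15 = NE2; dag-n15-c g11's located (Γ10) «torus example instantiating 61's hξ —
# non-vacuity of the partition hypotheses», carried from `ZMod (K·m)` to King's torus pair; s1 «background-layer OPERATOR ingredient»)

Cell `pub-ymgap`, seat `pub-ymgap-dag-n15-w4` (director №399 (3a) width; HUMAN RULING D-0062), generation 0.  `bears_on: R4∕N15 · K3⁷ SpineGivenEndpointR13SepCoPH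
(stmt-QuantumFields-20544)`.  Filed `--supports stmt-QuantumFields-20544 --as helper` — COUNT-NEUTRAL.  Theorems only (0 `def`, 0 `sorry`; the coordinates are written inline as
`fun ν x => ((x ν).val : ℝ) ∕ m`).  Imports BY NAME this seat's FILE VI `…N15PartitionTwoGridFitSecond` (`abs_fgradAdj_fgrad_hcube_two_grid_le`, `abs_bgrad_hcube_two_grid_le`; through it
FILES 64∕61∕60: `abs_fgrad_hcube_two_grid_le`, `hcube`, `abs_fgrad_hcube_le`, `abs_bgrad_hcube_le`, `abs_fgradAdj_fgrad_hcube_le`, `abs_hcube_sub_hcube_le`, `abs_cenRep_le_abs_sub`) and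
the dag-n15-b∕-a line file `…N15KingTorusLine` (`unitVec`, `unitVec_same`, `unitVec_of_ne`; through it the tree's `B5Prop11Plancherel.Tor`∕`fine` and `King1986.Torus.site`∕`blockOf`∕
`blockEquiv`∕`val_site`∕`blockOf_site`).  The shifts are `Equiv.addRight (unitVec N μ)` (= dag-n15-w3's `torStep N μ` definitionally).  Nothing in the tree is modified.

WHY.  FILES 45–58 (the two-spacing gluing) and 61∕64∕VI (the sampled partition) DISPLAY the partition's coordinates `ξ_ν` with the shift compatibility
`ξ_ν(e_μ x) ≡ ξ_ν(x) + δ_{νμ}s (mod K)` (`hξ`), and at two spacings the block offsets `ξ′_ν x′ = ξ_ν(πx′) + i_ν s′ (mod K)`, `0 ≤ i_ν ≤ L` (`hoff`).  Their consumer carrier is King's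
multi-period torus `Tor N = Π_μ ℤ∕N_μ` with the fine torus `Tor (fine L N)` blocked by `blockOf L N` (`site L N b j = L·b + j`) — dag-n15-a∕-e∕-w3's knit carrier.  THIS FILE inhabits
the displayed data there: §1 `exists_val_add_one_div_eq` — on `ZMod (K·m)`, `(x + 1).val∕m = x.val∕m + 1∕m + zK` with `z ∈ {0, −1}` (the wrap); §2 ★★ `kingTorus_hξ` — `hξ` for
`ξ_ν x = x_ν.val∕m`, `e_μ = · + e_μ`, `s = 1∕m` whenever `N_μ = K·m` for all `μ`; §3 ★★ `kingTorus_hξ_fine` (`s′ = 1∕(Lm)` on `Tor (fine L N)`) and ★★ `kingTorus_hoff` (`i_ν = j_ν`, the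
in-block digit, `z = 0`, by `val_site`∕`blockOf_site`); §4 the COROLLARIES with every displayed hypothesis discharged (`K ≥ 2`, `m ≥ 3`, `L ≥ 1`, any real inverse spacing `n`, fine
inverse spacing `n′ = L·n`, `κ = n∕m`): `abs_fgrad∕bgrad_hcube_kingTorus_le` (`|∇^±h| ≤ |n|π∕m`), `abs_fgradAdj_fgrad_hcube_kingTorus_le` (`|∇*∇h| ≤ 32π²n²∕m²`), `abs_hcube_sub_hcube_kingTorus_le`
(value fit `|h′(x′) − h(blockOf x′)| ≤ π·d·(L−1)∕(Lm)`), ★★ `abs_fgrad_hcube_two_grid_kingTorus_le` ∕ `abs_bgrad_…` (`≤ (|n|∕m)(1∕m)(64π² + π²d)`), ★★★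
`abs_fgradAdj_fgrad_hcube_two_grid_kingTorus_le` (`o₂ ≤ (n∕m)²(1∕m)(144π³ + 32π³d)`).

HONEST FRAMING ∕ LIMITS.  `ZMod.val` arithmetic and one-line instances of FILES 61∕64∕VI; an A6-style NON-VACUITY certificate for the PARTITION side of the gluing only — the
OPERATOR side (cube entries, `hloc`, cut rows) stays the consumer's; [B6] (2.36) p.229 = SHAPE, nothing of [B5]∕[B6]∕[B9] asserted.  NE2⁺ NOT PRINTED, NOT proved; N15 NOT
discharged; counts of record UNMOVED (typed 28∕28 · discharged 5∕27); one finite 𝕋⁴ at fixed ε — NOT infinite volume, NOT OS on ℝ⁴, NOT a mass gap, NOT Clay; R4 closes the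
conditional finite-𝕋⁴ rung `BalabanLadder.UV` only.  Restate-immune (no Theses import).
-/

noncomputable section

namespace Summit.QuantumFields.YangMills.BalabanUVNodes.N15.Gluing

open Real
open Literature.MathematicalPhysics.QuantumFieldTheory.Balaban1983to89.B5Prop11Plancherel (Tor fine)
open Literature.MathematicalPhysics.QuantumFieldTheory.King1986.Torus (site blockEquiv blockEquiv_apply blockOf blockOf_site val_site)
open Summit.QuantumFields.YangMills.BalabanUVNodes.N15.KingTorusLine (unitVec unitVec_same unitVec_of_ne)
open Summit.QuantumFields.YangMills.BalabanUVNodes.N15.BackgroundLayer (fgrad fgradAdj bgrad)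

/-! ## §1 One cyclic coordinate: the wrap -/

/-- On `ℤ∕n` with `n = K·m`, `m ≥ 1`: `(x + 1).val∕m = x.val∕m + 1∕m + z·K` with `z = 0` (no wrap) or `z = −1` (wrap at `x.val = n − 1`). [folklore] -/
theorem exists_val_add_one_div_eq {n K m : ℕ} [NeZero n] (hn : n = K * m) (hm : 0 < m) (x : ZMod n) :
    ∃ z : ℤ, (z = 0 ∨ z = -1) ∧ (((x + 1).val : ℕ) : ℝ) / m = ((x.val : ℕ) : ℝ) / m + 1 / m + z * K := by
  have hmr : (0 : ℝ) < m := by exact_mod_cast hm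
  have hv : (x + 1).val = (x.val + 1) % n := by rw [ZMod.val_add, ZMod.val_one_eq_one_mod, Nat.add_mod_mod]
  have hlt := ZMod.val_lt x
  by_cases h : x.val + 1 < n
  · refine ⟨0, Or.inl rfl, ?_⟩
    rw [hv, Nat.mod_eq_of_lt h]
    push_cast
    ring
  · have heq : x.val + 1 = n := by omega
    refine ⟨-1, Or.inr rfl, ?_⟩
    rw [hv, heq, Nat.mod_self]
    have e : ((x.val : ℕ) : ℝ) + 1 = (K : ℝ) * m := by
      have := congrArg (fun t : ℕ => (t : ℝ)) heq
      simp only [Nat.cast_add, Nat.cast_one] at this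
      rw [this, hn]; push_cast; ring
    push_cast
    field_simp
    linarith

/-! ## §2 The shift compatibility `hξ` on King's torus -/

section Coarse

variable {d : ℕ} {N : Fin d → ℕ} [hNz : ∀ μ, NeZero (N μ)] {K m : ℕ}

/-- ★★ **FILE 61's `hξ` ON KING'S TORUS**: for `N_μ = K·m` (all `μ`), `m ≥ 1`, the coordinates `ξ_ν(x) = x_ν.val∕m` and the translations `e_μ = · + e_μ` satisfy
`ξ_ν(e_μ x) = ξ_ν(x) + δ_{νμ}∕m + z·K` with `z ∈ ℤ` (indeed `z ∈ {0, −1}`). [cite: Balaban1984PropagatorsII, (2.36) p.229 (cubes of side `M` on the torus: shape)] -/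
theorem kingTorus_hξ (hN : ∀ μ, N μ = K * m) (hm : 0 < m) (μ ν : Fin d) (x : Tor N) :
    ∃ z : ℤ, (((Equiv.addRight (unitVec N μ) x) ν).val : ℝ) / m = (((x ν).val : ℕ) : ℝ) / m + (if ν = μ then (1 : ℝ) / m else 0) + z * K := by
  simp only [Equiv.coe_addRight, Pi.add_apply]
  by_cases hν : ν = μ
  · subst hν
    rw [unitVec_same, if_pos rfl]
    obtain ⟨z, _, hz⟩ := exists_val_add_one_div_eq (hN ν) hm (x ν)
    exact ⟨z, hz⟩
  · rw [unitVec_of_ne _ hν, add_zero, if_neg hν, add_zero]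
    exact ⟨0, by push_cast; ring⟩

/-- ★ `|∇_μ h_k| ≤ |n|·π∕m` on King's torus (FILE 61 `abs_fgrad_hcube_le`, `hξ` discharged). [cite: Balaban1984PropagatorsII, (2.36) p.229] -/
theorem abs_fgrad_hcube_kingTorus_le (hN : ∀ μ, N μ = K * m) (hK : 0 < K) (hm : 0 < m) (n : ℝ) (k : Fin d → ZMod K) (μ : Fin d) (x : Tor N) :
    |fgrad n (Equiv.addRight (unitVec N μ)) (hcube K (fun ν (x : Tor N) => (((x ν).val : ℕ) : ℝ) / m) k) x| ≤ |n| * (π * (1 / m)) := by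
  have hmr : (0 : ℝ) < m := by exact_mod_cast hm
  have h := abs_fgrad_hcube_le K (fun ν (x : Tor N) => (((x ν).val : ℕ) : ℝ) / m) (fun μ => Equiv.addRight (unitVec N μ)) hK (kingTorus_hξ hN hm) n k μ x
  rwa [abs_of_pos (by positivity : (0 : ℝ) < 1 / m)] at h

/-- ★ `|∇⁻_μ h_k| ≤ |n|·π∕m` on King's torus (FILE 61 `abs_bgrad_hcube_le`). [cite: Balaban1984PropagatorsII, (2.36) p.229] -/
theorem abs_bgrad_hcube_kingTorus_le (hN : ∀ μ, N μ = K * m) (hK : 0 < K) (hm : 0 < m) (n : ℝ) (k : Fin d → ZMod K) (μ : Fin d) (x : Tor N) :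
    |bgrad n (Equiv.addRight (unitVec N μ)) (hcube K (fun ν (x : Tor N) => (((x ν).val : ℕ) : ℝ) / m) k) x| ≤ |n| * (π * (1 / m)) := by
  have hmr : (0 : ℝ) < m := by exact_mod_cast hm
  have h := abs_bgrad_hcube_le K (fun ν (x : Tor N) => (((x ν).val : ℕ) : ℝ) / m) (fun μ => Equiv.addRight (unitVec N μ)) hK (kingTorus_hξ hN hm) n k μ x
  rwa [abs_of_pos (by positivity : (0 : ℝ) < 1 / m)] at h

/-- ★ `|∇*_μ∇_μ h_k| ≤ n²·32π²∕m²` on King's torus (FILE 61 `abs_fgradAdj_fgrad_hcube_le`; `K ≥ 2`, `m ≥ 1`). [cite: Balaban1984PropagatorsII, (2.36) p.229] -/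
theorem abs_fgradAdj_fgrad_hcube_kingTorus_le (hN : ∀ μ, N μ = K * m) (hK : 2 ≤ K) (hm : 0 < m) (n : ℝ) (k : Fin d → ZMod K) (μ : Fin d) (x : Tor N) :
    |fgradAdj n (Equiv.addRight (unitVec N μ)) (fgrad n (Equiv.addRight (unitVec N μ)) (hcube K (fun ν (x : Tor N) => (((x ν).val : ℕ) : ℝ) / m) k)) x|
      ≤ n ^ 2 * (32 * π ^ 2 * (1 / m) ^ 2) := by
  have hmr : (1 : ℝ) ≤ m := by exact_mod_cast hm
  exact abs_fgradAdj_fgrad_hcube_le K (fun ν (x : Tor N) => (((x ν).val : ℕ) : ℝ) / m) (fun μ => Equiv.addRight (unitVec N μ)) hK (kingTorus_hξ hN hm) (by positivity)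
    ((div_le_one (by positivity)).2 hmr) n k μ x

end Coarse

/-! ## §3 Two spacings: the fine coordinates and the block offsets -/

section TwoGrid

variable {d : ℕ} (L : ℕ) [NeZero L] {N : Fin d → ℕ} [hNz : ∀ μ, NeZero (N μ)] {K m : ℕ}

/-- ★★ **`hξ′` ON THE FINE TORUS** `Tor (fine L N)` (`fine L N μ = L·N_μ = K·(Lm)`): `ξ′_ν(x′) = x′_ν.val∕(Lm)`, `s′ = 1∕(Lm)`. [cite: Balaban1984PropagatorsII, (2.36) p.229 (shape)] -/
theorem kingTorus_hξ_fine (hN : ∀ μ, N μ = K * m) (hm : 0 < m) (μ ν : Fin d) (x' : Tor (fine L N)) :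
    ∃ z : ℤ, (((Equiv.addRight (unitVec (fine L N) μ) x') ν).val : ℝ) / ((L : ℝ) * m) = (((x' ν).val : ℕ) : ℝ) / ((L : ℝ) * m) + (if ν = μ then (1 : ℝ) / ((L : ℝ) * m) else 0) + z * K := by
  have hL : 0 < L := Nat.pos_of_ne_zero (NeZero.ne L)
  have hN' : ∀ μ, fine L N μ = K * (L * m) := fun μ => by
    show L * N μ = K * (L * m); rw [hN μ]; ring
  have h := kingTorus_hξ (N := fine L N) (K := K) (m := L * m) hN' (Nat.mul_pos hL hm) μ ν x'
  push_cast at h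
  exact h

/-- ★★ **FILE 64's BLOCK-OFFSET HYPOTHESIS `hoff` ON KING'S TORUS PAIR**: `ξ′_ν(x′) = ξ_ν(blockOf x′) + j_ν·(1∕(Lm)) + 0·K` with `j_ν < L` the in-block digit (`x′ = L·b + j`). [folklore] -/
theorem kingTorus_hoff (K : ℕ) (hm : 0 < m) (ν : Fin d) (x' : Tor (fine L N)) :
    ∃ i : ℕ, i ≤ L ∧ ∃ z : ℤ, (((x' ν).val : ℕ) : ℝ) / ((L : ℝ) * m) = ((((blockOf L N x') ν).val : ℕ) : ℝ) / m + i * (1 / ((L : ℝ) * m)) + z * K := by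
  have hL : 0 < L := Nat.pos_of_ne_zero (NeZero.ne L)
  have hLr : (0 : ℝ) < L := by exact_mod_cast hL
  have hmr : (0 : ℝ) < m := by exact_mod_cast hm
  obtain ⟨⟨b, j⟩, rfl⟩ := (blockEquiv L N).surjective x'
  rw [blockEquiv_apply, blockOf_site, val_site]
  refine ⟨(j ν : ℕ), (j ν).isLt.le, 0, ?_⟩
  push_cast
  rw [zero_mul, add_zero]
  field_simp

variable {L}

/-- ★ **THE VALUE FIT `hfit` ON KING'S TORUS PAIR**: `|h′_k(x′) − h_k(blockOf x′)| ≤ π·d·(L − 1)∕(Lm)` (FILE 61 `abs_hcube_sub_hcube_le`, offsets `j_ν ≤ L − 1`). [cite: Balaban1985BackgroundPropagators, Thm 3.14 pp.426–427 (difference template: shape)] -/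
theorem abs_hcube_sub_hcube_kingTorus_le (hK : 0 < K) (hm : 0 < m) (k : Fin d → ZMod K) (x' : Tor (fine L N)) :
    |hcube K (fun ν (x' : Tor (fine L N)) => (((x' ν).val : ℕ) : ℝ) / ((L : ℝ) * m)) k x' - hcube K (fun ν (x : Tor N) => (((x ν).val : ℕ) : ℝ) / m) k (blockOf L N x')|
      ≤ π * d * (((L : ℝ) - 1) / ((L : ℝ) * m)) := by
  have hL : 0 < L := Nat.pos_of_ne_zero (NeZero.ne L)
  have hLr : (0 : ℝ) < L := by exact_mod_cast hL
  have hmr : (0 : ℝ) < m := by exact_mod_cast hm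
  refine (abs_hcube_sub_hcube_le K _ _ hK k x' (blockOf L N x')).trans ?_
  rw [mul_assoc]
  refine mul_le_mul_of_nonneg_left ?_ Real.pi_pos.le
  obtain ⟨⟨b, j⟩, rfl⟩ := (blockEquiv L N).surjective x'
  have hterm : ∀ ν : Fin d, |cenRep K ((((site L N b j ν).val : ℕ) : ℝ) / ((L : ℝ) * m) - ((((blockOf L N (site L N b j)) ν).val : ℕ) : ℝ) / m)| ≤ ((L : ℝ) - 1) / ((L : ℝ) * m) := by
    intro ν
    rw [blockOf_site, val_site]
    have e : (((L * (b ν).val + (j ν : ℕ) : ℕ) : ℝ)) / ((L : ℝ) * m) - (((b ν).val : ℕ) : ℝ) / m = ((j ν : ℕ) : ℝ) / ((L : ℝ) * m) := by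
      push_cast; field_simp; ring
    rw [e]
    refine (abs_cenRep_le_abs_sub hK _ 0).trans ?_
    rw [Int.cast_zero, zero_mul, sub_zero, abs_of_nonneg (by positivity)]
    refine div_le_div_of_nonneg_right ?_ (by positivity)
    have : (j ν : ℕ) + 1 ≤ L := (j ν).isLt
    have : ((j ν : ℕ) : ℝ) + 1 ≤ L := by exact_mod_cast this
    linarith
  calc ∑ ν : Fin d, |cenRep K ((((blockEquiv L N (b, j)) ν).val : ℝ) / ((L : ℝ) * m) - ((((blockOf L N (blockEquiv L N (b, j))) ν).val : ℕ) : ℝ) / m)|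
      ≤ ∑ ν : Fin d, ((L : ℝ) - 1) / ((L : ℝ) * m) := Finset.sum_le_sum fun ν _ => by rw [blockEquiv_apply]; exact hterm ν
    _ = d * (((L : ℝ) - 1) / ((L : ℝ) * m)) := by rw [Finset.sum_const, Finset.card_univ, Fintype.card_fin, nsmul_eq_mul]

/-- ★★ **THE TWO-GRID FIT `hf1` ON KING'S TORUS PAIR** (FILE 64 `abs_fgrad_hcube_two_grid_le` with `s = 1∕m`, `s′ = 1∕(Lm)`, `n′ = L·n`, `κ = n∕m`; `K ≥ 2`, `m ≥ 1`):
`|∇′_μ h′_k(x′) − ∇_μ h_k(blockOf x′)| ≤ (|n|∕m)·(1∕m)·(64π² + π²d)`. [cite: Balaban1984PropagatorsII, (2.36) p.229; Balaban1985BackgroundPropagators, Thm 3.14 pp.426–427 (difference template)] -/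
theorem abs_fgrad_hcube_two_grid_kingTorus_le (hN : ∀ μ, N μ = K * m) (hK : 2 ≤ K) (hm : 0 < m) (n : ℝ) (k : Fin d → ZMod K) (μ : Fin d) (x' : Tor (fine L N)) :
    |fgrad (L * n) (Equiv.addRight (unitVec (fine L N) μ)) (hcube K (fun ν (x' : Tor (fine L N)) => (((x' ν).val : ℕ) : ℝ) / ((L : ℝ) * m)) k) x'
      - fgrad n (Equiv.addRight (unitVec N μ)) (hcube K (fun ν (x : Tor N) => (((x ν).val : ℕ) : ℝ) / m) k) (blockOf L N x')|
      ≤ |n| / m * (1 / m) * (64 * π ^ 2 + π ^ 2 * d) := by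
  have hL : 0 < L := Nat.pos_of_ne_zero (NeZero.ne L)
  have hL1 : 1 ≤ L := hL
  have hLr : (0 : ℝ) < L := by exact_mod_cast hL
  have hmr : (0 : ℝ) < m := by exact_mod_cast hm
  have hm1 : (1 : ℝ) ≤ m := by exact_mod_cast hm
  have hL1r : (1 : ℝ) ≤ L := by exact_mod_cast hL1
  have h := abs_fgrad_hcube_two_grid_le K (fun ν (x : Tor N) => (((x ν).val : ℕ) : ℝ) / m) (fun ν (x' : Tor (fine L N)) => (((x' ν).val : ℕ) : ℝ) / ((L : ℝ) * m))
    (blockOf L N) (fun μ => Equiv.addRight (unitVec N μ)) (fun μ => Equiv.addRight (unitVec (fine L N) μ)) hK (s := 1 / m) (s' := 1 / ((L : ℝ) * m)) (κ := n / m) (n := n)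
    (n' := L * n) hL1 (by positivity) (by rw [div_le_one (by positivity)]; nlinarith [hL1r, hm1]) (by field_simp) (by field_simp) (by field_simp)
    (kingTorus_hξ hN hm) (kingTorus_hξ_fine L hN hm) (kingTorus_hoff L K hm) k μ x'
  rw [abs_div, Nat.abs_cast, Fintype.card_fin] at h
  exact h

/-- ★★ **THE TWO-GRID FIT `hf1b` ON KING'S TORUS PAIR** (FILE VI `abs_bgrad_hcube_two_grid_le`): `|∇′⁻_μ h′_k(x′) − ∇⁻_μ h_k(blockOf x′)| ≤ (|n|∕m)·(1∕m)·(64π² + π²d)`.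
[cite: Balaban1984PropagatorsII, (2.36) p.229; Balaban1985BackgroundPropagators, Thm 3.14 pp.426–427 (difference template)] -/
theorem abs_bgrad_hcube_two_grid_kingTorus_le (hN : ∀ μ, N μ = K * m) (hK : 2 ≤ K) (hm : 0 < m) (n : ℝ) (k : Fin d → ZMod K) (μ : Fin d) (x' : Tor (fine L N)) :
    |bgrad (L * n) (Equiv.addRight (unitVec (fine L N) μ)) (hcube K (fun ν (x' : Tor (fine L N)) => (((x' ν).val : ℕ) : ℝ) / ((L : ℝ) * m)) k) x'
      - bgrad n (Equiv.addRight (unitVec N μ)) (hcube K (fun ν (x : Tor N) => (((x ν).val : ℕ) : ℝ) / m) k) (blockOf L N x')|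
      ≤ |n| / m * (1 / m) * (64 * π ^ 2 + π ^ 2 * d) := by
  have hL : 0 < L := Nat.pos_of_ne_zero (NeZero.ne L)
  have hL1 : 1 ≤ L := hL
  have hLr : (0 : ℝ) < L := by exact_mod_cast hL
  have hmr : (0 : ℝ) < m := by exact_mod_cast hm
  have hm1 : (1 : ℝ) ≤ m := by exact_mod_cast hm
  have hL1r : (1 : ℝ) ≤ L := by exact_mod_cast hL1
  have h := abs_bgrad_hcube_two_grid_le K (fun ν (x : Tor N) => (((x ν).val : ℕ) : ℝ) / m) (fun ν (x' : Tor (fine L N)) => (((x' ν).val : ℕ) : ℝ) / ((L : ℝ) * m))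
    (blockOf L N) (fun μ => Equiv.addRight (unitVec N μ)) (fun μ => Equiv.addRight (unitVec (fine L N) μ)) hK (s := 1 / m) (s' := 1 / ((L : ℝ) * m)) (κ := n / m) (n := n)
    (n' := L * n) hL1 (by positivity) (by rw [div_le_one (by positivity)]; nlinarith [hL1r, hm1]) (by field_simp) (by field_simp) (by field_simp)
    (kingTorus_hξ hN hm) (kingTorus_hξ_fine L hN hm) (kingTorus_hoff L K hm) k μ x'
  rw [abs_div, Nat.abs_cast, Fintype.card_fin] at h
  exact h

/-- ★★★ **THE SECOND-DERIVATIVE TWO-GRID FIT `hf2` (`o₂`) ON KING'S TORUS PAIR** (FILE VI `abs_fgradAdj_fgrad_hcube_two_grid_le`; `K ≥ 2`, `m ≥ 3` so that `s′ ≤ 1∕3`):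
`|∇′*_μ∇′_μ h′_k(x′) − ∇*_μ∇_μ h_k(blockOf x′)| ≤ (n∕m)²·(1∕m)·(144π³ + 32π³d)`. [cite: Balaban1984PropagatorsII, (2.36) p.229; Balaban1985BackgroundPropagators, Thm 3.14 pp.426–427 (difference template)] -/
theorem abs_fgradAdj_fgrad_hcube_two_grid_kingTorus_le (hN : ∀ μ, N μ = K * m) (hK : 2 ≤ K) (hm : 3 ≤ m) (n : ℝ) (k : Fin d → ZMod K) (μ : Fin d) (x' : Tor (fine L N)) :
    |fgradAdj (L * n) (Equiv.addRight (unitVec (fine L N) μ)) (fgrad (L * n) (Equiv.addRight (unitVec (fine L N) μ))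
        (hcube K (fun ν (x' : Tor (fine L N)) => (((x' ν).val : ℕ) : ℝ) / ((L : ℝ) * m)) k)) x'
      - fgradAdj n (Equiv.addRight (unitVec N μ)) (fgrad n (Equiv.addRight (unitVec N μ)) (hcube K (fun ν (x : Tor N) => (((x ν).val : ℕ) : ℝ) / m) k)) (blockOf L N x')|
      ≤ (n / m) ^ 2 * (1 / m) * (144 * π ^ 3 + 32 * π ^ 3 * d) := by
  have hL : 0 < L := Nat.pos_of_ne_zero (NeZero.ne L)
  have hL1 : 1 ≤ L := hL
  have hLr : (1 : ℝ) ≤ L := by exact_mod_cast hL1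
  have hm0 : 0 < m := by omega
  have hmr : (0 : ℝ) < m := by exact_mod_cast hm0
  have hm3 : (3 : ℝ) ≤ m := by exact_mod_cast hm
  have hs1 : 1 / ((L : ℝ) * m) ≤ 1 / 3 := one_div_le_one_div_of_le (by norm_num) (by nlinarith [hLr, hm3])
  have hs2 : (1 : ℝ) / m ≤ 1 := by rw [div_le_one hmr]; linarith
  have h := abs_fgradAdj_fgrad_hcube_two_grid_le K (fun ν (x : Tor N) => (((x ν).val : ℕ) : ℝ) / m) (fun ν (x' : Tor (fine L N)) => (((x' ν).val : ℕ) : ℝ) / ((L : ℝ) * m))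
    (blockOf L N) (fun μ => Equiv.addRight (unitVec N μ)) (fun μ => Equiv.addRight (unitVec (fine L N) μ)) hK (s := 1 / m) (s' := 1 / ((L : ℝ) * m)) (κ := n / m) (n := n)
    (n' := L * n) hL1 (by positivity) hs1 hs2 (by field_simp) (by field_simp) (by field_simp)
    (kingTorus_hξ hN hm0) (kingTorus_hξ_fine L hN hm0) (kingTorus_hoff L K hm0) k μ x'
  rw [Fintype.card_fin] at h
  exact h

end TwoGrid

end Summit.QuantumFields.YangMills.BalabanUVNodes.N15.Gluing

end
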